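import Summits.Langlands.Langlands.Theses.FifteenLocusEisenstein
import Literature.NumberTheory.Automorphic.CompletedCohomologyHeckeAlgebraGLn

/-!
# BIRTH SKELETON (BC3) — crux stmt-Langlands-16054 `FifteenLocusEisenstein.NonOrdinaryEisensteinModular`
(route `route-Langlands-FifteenLocusEisenstein`, rank 2), line `birth`, TYPED.

Registered by `planner-skel-stmt-Langlands-16054-0` (skeleton registrar, 2026-08-17). Three NAMED stubs,
the kernel-checked composition `NonOrdinaryEisensteinModular_of : NonOrdinaryEisensteinModular` (BY NAME,
the stubs used by name in its body — the shape `#h21_check_skeleton` registers) and, as an `example`, the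
same composition in hypothetical form `<stub₁-sig> → <stub₂-sig> → <stub₃-sig> → NonOrdinaryEisensteinModular`
(sorry-free pure logic).

## The cut (pro-modularity / classicality, as the parent engine `SkinnerWilesDefectOne` is cut, one sector over)

The crux: `F` imaginary quadratic, `p` odd, `E/𝓞_F` an integral Weierstrass model with `Δ ≠ 0`, no geometric
CM, `E[p]` REDUCIBLE, and NO irreducible Tate frame `ρ : Γ_F → GL₂(ℚ̄_p)` of `E` (irreducible, a.e.
unramified, arithmetic-Frobenius charpoly `X² − a_w(E) X + N w` a.e.) is nearly ordinary of weight 2 at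
every `v ∣ p` ⟹ `E` is modular in point-count form (`Σα⁻¹ = a_w(E)`, `Πα⁻¹ = N w` a.e., every level
witness `hcpt`).  The line unpacks the doubly-negated hypothesis into Skinner–Wiles-shaped DATA and then
runs the two halves of an `R = 𝕋` argument in the completed cohomology of the Bianchi threefold:

* `stub_borelTateFrame` (M/L, PROVABLE-IN-KIND — the "common first lemma" the route header foresees, with the
  Ribet/isogeny lattice added): for ANY number field `F`, prime `p`, integral model `E` with `Δ ≠ 0`, no
  geometric CM and `E[p]` reducible, there is an irreducible Tate frame `ρ` of `E` at `p` together with a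
  residually upper-triangular integral model `ρ₀ : Γ_F → GL₂(O)` over the valuation ring `O` of `ℚ̄_p`
  (`HasUpperTriangularIntegralModel`).  Content: `ρ = V_pE ⊗ ℚ̄_p` framed on a `ℤ_p`-basis of `T_pE` whose
  first vector lifts a generator of the `Γ_F`-stable line of `E[p]` (pattern of the banked
  `SkinnerWilesDefectOneFiveIsogenyEllipticCurvesIntegralFrame`, there for `p = 5`); a.e. unramified with
  charpoly `X² − a_w X + N w` by the tree's PROVED Hasse–Weil package
  (`hasFrobCharpolyAt_rationalTateGaloisRepOf_of_hasGoodReductionAt`,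
  `trace/det_galoisRepTate_frobenius_of_hasGoodReductionAt_holds`, `frobeniusTraceAt_baseChange_eq_frobTraceAt`);
  irreducible because `End_{F̄}(E) = ℤ` (Faltings' isogeny theorem: tree `faltings_tate_bijective…`,
  `FaltingsEC…`; or Serre IV.2.1-type local arguments where available).
* `stub_proModularNonOrdinary` (OPEN — the crux's lever, "non-ordinary residually reducible pro-modularity at
  defect one"): for `F` imaginary quadratic, `p` odd, such a Borel-framed irreducible Tate frame `ρ` of a
  non-CM `E` with `E[p]` reducible that is NOT nearly ordinary of weight 2 at some `v ∣ p` is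
  `p`-ADICALLY AUTOMORPHIC: `∃ 𝒰 : TameLevel 2 F p, 𝒰.IsPadicallyAutomorphic ρ` (a continuous `ℚ̄_p`-point
  of the big Hecke algebra `𝕋(K^p)` of `GL₂/F` associated with `ρ`; vocabulary
  `Literature.NumberTheory.Automorphic.CompletedCohomologyHeckeAlgebraGLn`, constructed, no named fact in
  its cone — the same receptacle as the parent engine's `ReducibleOrdinaryProModular`).  Mechanism named by
  the route: fixed-weight (potentially Barsotti–Tate, Kisin local rings at every `F_v`) Schur-reducible
  lifting — Ribet lattice `c ∈ H¹(F, χ'χ⁻¹)` non-split, Thorne/ANT `μ₂²`-action, trace subring étale at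
  irreducible points, Calegari–Geraghty patched complexes in degrees `[1,2]`, reducible locus finite at
  fixed weight (`h¹_f(ψ(1)) ≤ 1`, `h¹_f(ψ(−1)) = 0`).  TRUE in expectation (every `E/F` is expected
  modular, and a weight-2 trivial-coefficient Bianchi eigensystem is a point of `𝕋(K^p)`); OPEN as a
  theorem: no non-ordinary residually reducible lifting is in print off `F_v = ℚ_p` (Pan2022,
  arXiv:2411.18661 need `p`-adic local Langlands for `GL₂(ℚ_p)`).
* `stub_potBTClassicality` (OPEN, different toolbox — classicality of pro-modular weight-(0,1) points): for
  the same family, an irreducible Tate frame `ρ` of `E` (not nearly ordinary at some `v ∣ p`) that is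
  `p`-adically automorphic of some tame level is CLASSICAL of weight 2: for every level witness `hcpt` an
  L-algebraic cuspidal `π` on `GL₂(𝔸_F)` with `Σα⁻¹ = a_w(E)`, `Πα⁻¹ = N w` a.e. (verbatim the crux
  conclusion).  Templates: Emerton 2011 / Kisin (over `ℚ`: local–global compatibility in completed
  cohomology ⇒ Fontaine–Mazur for pot-BT points), small-slope control for Bianchi overconvergent
  cohomology (Barrera Salazar–Williams; slopes of a supersingular `a_v` lie in `(0,1)`, non-critical for
  weight 2) plus an eigenvariety ↔ completed-cohomology comparison (Emerton's Jacquet functor; Hansen);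
  the parent's ordinary analogue is `SkinnerWilesDefectOne.ProModularOrdinaryClassical` (Hida control).

None of the three is the crux or the summit in costume: stub 1 produces data and says nothing about
automorphy; stub 2 concludes PRO-modularity (a statement about `𝕋(K^p)`, not implied by `Langlands` by any
cheap step) from ONE Borel-framed datum; stub 3 assumes pro-modularity.  The BC3 probes
`stub → NonOrdinaryEisensteinModular` / `stub → Langlands` by `first | exact? | simpa | aesop` fail
(bc/ probe files, NOTES.md of the registrar).

Disproof used: none — no `Disproof.lean` exists on this crux at registration time (`ledger crux ls
stmt-Langlands-16054`: no workfiles).  Dead lines: none recorded.  Barriers honoured as the route header says: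
`ResiduallyReducibleBarrier(Narrow)` — the residual representation is the NON-SPLIT Ribet lattice inside stub 2,
never a decomposable `V̄`; `TaylorWilesNumericalCoincidence(Narrow)` (defect `l₀ = 1`) — isolated in stub 2
(CG complexes / completed cohomology, no single-degree patching); stub 3 carries the classicality risk only.

Leans on (by name): `Summit.Langlands.Langlands.Theses.FifteenLocusEisenstein.NonOrdinaryEisensteinModular`
(the crux), `Literature.NumberTheory.GaloisRepresentations.FramedGaloisRep` (`IsUnramifiedAt`,
`HasFrobCharpolyAt`, `IsOrdinaryOfWeightAt`, `HasUpperTriangularIntegralModel`, `toGaloisRep.IsIrreducible`),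
`Literature.NumberTheory.Automorphic.frobTraceAt`, `…BigHeckeGLn.TameLevel`, `…TameLevel.IsPadicallyAutomorphic`,
`CuspidalAutomorphicRepData`, `AutomorphicRepData.HasSatakeParamAt`, `isCompact_glFiniteIntegralLevel`,
`WeierstrassCurve.HasCM`, `WeierstrassCurve.HasIrreducibleModPGaloisRep`, `PadicAlgCl`, `Valued.v`.
-/

noncomputable section

open scoped MatrixGroups NumberField Polynomial
open Filter

-- `Summit.Langlands.Langlands.…`: summit = sub-problem name (D-0017 nested layout), not a typo.
set_option linter.dupNamespace false

namespace Summit.Langlands.Langlands.Cruxes.NonOrdinaryEisensteinModular.Birth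

/-- **STUB 1 — `BorelTateFrame` (an irreducible Tate frame in Ribet/isogeny-adapted integral form).**
For any number field `F`, prime `p` and integral Weierstrass model `E/𝓞_F` with `Δ ≠ 0`, no geometric CM and
`E[p]` reducible (`¬ HasIrreducibleModPGaloisRep p`: an `F`-rational `p`-isogeny), and for `O` the valuation
ring of `ℚ̄_p`: there is a framed `ρ : Γ_F → GL₂(ℚ̄_p)` which is an IRREDUCIBLE TATE FRAME of `E` at `p`
(irreducible; unramified with arithmetic-Frobenius characteristic polynomial `X² − a_w(E)X + N w` at almost
every `w`) and admits a residually upper-triangular integral model `ρ₀ : Γ_F → GL₂(O)` in the same frame.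
(`V_pE ⊗ ℚ̄_p` on a `ℤ_p`-basis of `T_pE` adapted to the isogeny kernel; Hasse–Weil from the tree; Faltings /
Serre irreducibility for non-CM `E`.) [cite: SerreAbelianLadic1968, Ch. I §1.1, IV.2.1]
[cite: SilvermanAEC2009, III.7, C.21] [cite: SkinnerWiles1999, §4.6] -/
theorem stub_borelTateFrame :
    ∀ (F : Type) [Field F] [NumberField F] (p : ℕ) [Fact p.Prime] (E : WeierstrassCurve (NumberField.RingOfIntegers F)), E.Δ ≠ 0 → ¬ (E.baseChange F).HasCM → ¬ (E.baseChange F).HasIrreducibleModPGaloisRep p → ∀ (O : ValuationSubring (PadicAlgCl p)), O = (Valued.v : Valuation (PadicAlgCl p) NNReal).valuationSubring → ∃ (ρ : Literature.NumberTheory.GaloisRepresentations.FramedGaloisRep F (PadicAlgCl p) 2) (ρ₀ : Field.absoluteGaloisGroup F →* Matrix.GeneralLinearGroup (Fin 2) O), (ρ.toGaloisRep.IsIrreducible ∧ ∀ᶠ w : IsDedekindDomain.HeightOneSpectrum (NumberField.RingOfIntegers F) in Filter.cofinite, ρ.IsUnramifiedAt w ∧ ρ.HasFrobCharpolyAt w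 (Polynomial.X ^ 2 - Polynomial.C ((Literature.NumberTheory.Automorphic.frobTraceAt E w : ℤ) : PadicAlgCl p) * Polynomial.X + Polynomial.C ((w.residueCard : ℕ) : PadicAlgCl p))) ∧ ρ.HasUpperTriangularIntegralModel ρ₀ := by
  sorry

/-- **STUB 2 — `ProModularNonOrdinary` (residually reducible, NON-ordinary pro-modularity at defect one —
the crux's lever).**  `F` imaginary quadratic (`IsTotallyComplex`, `finrank ℚ F = 2`), `p ≠ 2`, `O` the
valuation ring of `ℚ̄_p`, `E/𝓞_F` with `Δ ≠ 0`, no geometric CM and `E[p]` reducible; `ρ` an irreducible Tate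
frame of `E` at `p` with a residually upper-triangular integral model `ρ₀` over `O`, NOT nearly ordinary of
weight 2 at some `v ∣ p` (`∀ m > 0, ¬ IsOrdinaryOfWeightAt p v 2 m`: potentially supersingular at `v`) ⟹ `ρ`
is `p`-adically automorphic of some `S`-good tame level `𝒰` of `GL₂/F` (a continuous `ℚ̄_p`-point of the
completed-cohomology Hecke algebra `𝕋(K^p)` associated with `ρ`).  Fixed-weight Schur-reducible
potentially-Barsotti–Tate lifting in Calegari–Geraghty degrees `[1,2]`; OPEN.
[cite: Thorne2014] [cite: CalegariGeraghty2017] [cite: SkinnerWiles1999, §3–§4] [cite: Pan2022] -/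
theorem stub_proModularNonOrdinary :
    ∀ (F : Type) [Field F] [NumberField F], NumberField.IsTotallyComplex F → Module.finrank ℚ F = 2 → ∀ (p : ℕ) [Fact p.Prime], p ≠ 2 → ∀ (O : ValuationSubring (PadicAlgCl p)), O = (Valued.v : Valuation (PadicAlgCl p) NNReal).valuationSubring → ∀ (E : WeierstrassCurve (NumberField.RingOfIntegers F)), E.Δ ≠ 0 → ¬ (E.baseChange F).HasCM → ¬ (E.baseChange F).HasIrreducibleModPGaloisRep p → ∀ (ρ : Literature.NumberTheory.GaloisRepresentations.FramedGaloisRep F (PadicAlgCl p) 2) (ρ₀ : Field.absoluteGaloisGroup F →* Matrix.GeneralLinearGroup (Fin 2) O), (ρ.toGaloisRep.IsIrreducible ∧ ∀ᶠ w : IsDedekindDomain.HeightOneSpectrum (NumberField.RingOfIntegers F) in Filter.cofinite, ρ.IsUnramifiedAt w ∧ ρ.HasFrobCharpolyAt w (Polynomial.X ^ 2 - Polynomial.C ((Literature.NumberTheory.Automorphic.frobTraceAt E w : ℤ) : PadicAlgCl p) * Polynomial.X + Polynomial.C ((w.residueCard : ℕ) : PadicAlgCl p))) → ρ.HasUpperTriangularIntegralModel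 ρ₀ → (∃ v : IsDedekindDomain.HeightOneSpectrum (NumberField.RingOfIntegers F), (p : NumberField.RingOfIntegers F) ∈ v.asIdeal ∧ ∀ m : ℕ, 0 < m → ¬ ρ.IsOrdinaryOfWeightAt p v 2 m) → ∃ 𝒰 : Literature.NumberTheory.Automorphic.BigHeckeGLn.TameLevel 2 F p, 𝒰.IsPadicallyAutomorphic ρ := by
  sorry

/-- **STUB 3 — `PotBTClassicality` (pro-modular potentially-Barsotti–Tate points are classical of weight 2).**
`F` imaginary quadratic, `p ≠ 2`, `E/𝓞_F` with `Δ ≠ 0`, no geometric CM and `E[p]` reducible; `ρ` an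
irreducible Tate frame of `E` at `p`, not nearly ordinary of weight 2 at some `v ∣ p`, and `p`-adically
automorphic of some tame level ⟹ `E` is modular in point-count form: for every level witness `hcpt` an
L-algebraic cuspidal `π` on `GL₂(𝔸_F)` with `Σ_j α_j⁻¹ = a_w(E)` and `Π_j α_j⁻¹ = N w` at almost every `w`
(verbatim the crux conclusion).  Emerton/Kisin-shape classicality one field up (small-slope Bianchi control +
eigenvariety ↔ completed cohomology); the ordinary analogue is `SkinnerWilesDefectOne.ProModularOrdinaryClassical`.
OPEN. [cite: CalegariGeraghty2017] [cite: CaraianiNewton2023, Thm 4.2.15] [cite: Pan2022] -/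
theorem stub_potBTClassicality :
    ∀ (F : Type) [Field F] [NumberField F], NumberField.IsTotallyComplex F → Module.finrank ℚ F = 2 → ∀ (p : ℕ) [Fact p.Prime], p ≠ 2 → ∀ (E : WeierstrassCurve (NumberField.RingOfIntegers F)), E.Δ ≠ 0 → ¬ (E.baseChange F).HasCM → ¬ (E.baseChange F).HasIrreducibleModPGaloisRep p → ∀ (ρ : Literature.NumberTheory.GaloisRepresentations.FramedGaloisRep F (PadicAlgCl p) 2), (ρ.toGaloisRep.IsIrreducible ∧ ∀ᶠ w : IsDedekindDomain.HeightOneSpectrum (NumberField.RingOfIntegers F) in Filter.cofinite, ρ.IsUnramifiedAt w ∧ ρ.HasFrobCharpolyAt w (Polynomial.X ^ 2 - Polynomial.C ((Literature.NumberTheory.Automorphic.frobTraceAt E w : ℤ) : PadicAlgCl p) * Polynomial.X + Polynomial.C ((w.residueCard : ℕ) : PadicAlgCl p))) → (∃ v : IsDedekindDomain.HeightOneSpectrum (NumberField.RingOfIntegers F), (p : NumberField.RingOfIntegers F) ∈ v.asIdeal ∧ ∀ m : ℕ, 0 < m → ¬ ρ.IsOrdinaryOfWeightAt p v 2 m) →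 (∃ 𝒰 : Literature.NumberTheory.Automorphic.BigHeckeGLn.TameLevel 2 F p, 𝒰.IsPadicallyAutomorphic ρ) → ∀ (hcpt : Literature.NumberTheory.Automorphic.isCompact_glFiniteIntegralLevel 2 F), ∃ π : Literature.NumberTheory.Automorphic.CuspidalAutomorphicRepData 2 F hcpt, π.1.IsLAlgebraic ∧ ∀ᶠ w : IsDedekindDomain.HeightOneSpectrum (NumberField.RingOfIntegers F) in Filter.cofinite, ∃ α : Multiset ℂ, π.1.HasSatakeParamAt w α ∧ (α.map fun a => a⁻¹).sum = (Literature.NumberTheory.Automorphic.frobTraceAt E w : ℂ) ∧ (α.map fun a => a⁻¹).prod = (w.residueCard : ℂ) := by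
  sorry

/-- **The crux BY NAME from the three stubs** (the registered skeleton theorem: no hypotheses, the declared
stubs used by name in the body).  Fix the crux binders; stub 1 gives a Borel-framed irreducible Tate frame
`(ρ, ρ₀)` over the valuation ring of `ℚ̄_p`; the crux hypothesis "no irreducible Tate frame is nearly ordinary
of weight 2 at every `v ∣ p`", applied to THIS frame and pushed through the negations, gives a place `v ∣ p`
at which `ρ` is not nearly ordinary of weight 2 for any exponent; stub 2 makes `ρ` `p`-adically automorphic;
stub 3 makes it classical in point-count form. [folklore] -/
theorem NonOrdinaryEisensteinModular_of :
    Summit.Langlands.Langlands.Theses.FifteenLocusEisenstein.NonOrdinaryEisensteinModular := by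
  intro F _ _ htc hdeg p _ hp E hΔ hcm hred hA hcpt
  obtain ⟨ρ, ρ₀, hframe, hmod⟩ := stub_borelTateFrame F p E hΔ hcm hred _ rfl
  have hno : ∃ v : IsDedekindDomain.HeightOneSpectrum (NumberField.RingOfIntegers F),
      (p : NumberField.RingOfIntegers F) ∈ v.asIdeal ∧ ∀ m : ℕ, 0 < m → ¬ ρ.IsOrdinaryOfWeightAt p v 2 m := by
    by_contra h
    push Not at h
    exact hA ⟨ρ, hframe, h⟩
  obtain ⟨𝒰, h𝒰⟩ := stub_proModularNonOrdinary F htc hdeg p hp _ rfl E hΔ hcm hred ρ ρ₀ hframe hmod hno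
  exact stub_potBTClassicality F htc hdeg p hp E hΔ hcm hred ρ hframe hno ⟨𝒰, h𝒰⟩ hcpt

/-- **The same composition as PURE LOGIC, hypothetical form**
`<stub₁-sig> → <stub₂-sig> → <stub₃-sig> → NonOrdinaryEisensteinModular` (sorry-free and axiom-clean: this is
the real proof that the three stub statements imply the crux; written as an `example` so that the skeleton
audit sees exactly one theorem concluding the crux). [folklore] -/
example :
    (∀ (F : Type) [Field F] [NumberField F] (p : ℕ) [Fact p.Prime] (E : WeierstrassCurve (NumberField.RingOfIntegers F)), E.Δ ≠ 0 → ¬ (E.baseChange F).HasCM → ¬ (E.baseChange F).HasIrreducibleModPGaloisRep p → ∀ (O : ValuationSubring (PadicAlgCl p)), O = (Valued.v : Valuation (PadicAlgCl p) NNReal).valuationSubring → ∃ (ρ : Literature.NumberTheory.GaloisRepresentations.FramedGaloisRep F (PadicAlgCl p) 2) (ρ₀ : Field.absoluteGaloisGroup F →* Matrix.GeneralLinearGroup (Fin 2) O), (ρ.toGaloisRep.IsIrreducible ∧ ∀ᶠ w : IsDedekindDomain.HeightOneSpectrum (NumberField.RingOfIntegers F) in Filter.cofinite, ρ.IsUnramifiedAt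 w ∧ ρ.HasFrobCharpolyAt w (Polynomial.X ^ 2 - Polynomial.C ((Literature.NumberTheory.Automorphic.frobTraceAt E w : ℤ) : PadicAlgCl p) * Polynomial.X + Polynomial.C ((w.residueCard : ℕ) : PadicAlgCl p))) ∧ ρ.HasUpperTriangularIntegralModel ρ₀) →
    (∀ (F : Type) [Field F] [NumberField F], NumberField.IsTotallyComplex F → Module.finrank ℚ F = 2 → ∀ (p : ℕ) [Fact p.Prime], p ≠ 2 → ∀ (O : ValuationSubring (PadicAlgCl p)), O = (Valued.v : Valuation (PadicAlgCl p) NNReal).valuationSubring → ∀ (E : WeierstrassCurve (NumberField.RingOfIntegers F)), E.Δ ≠ 0 → ¬ (E.baseChange F).HasCM → ¬ (E.baseChange F).HasIrreducibleModPGaloisRep p → ∀ (ρ : Literature.NumberTheory.GaloisRepresentations.FramedGaloisRep F (PadicAlgCl p) 2) (ρ₀ : Field.absoluteGaloisGroup F →* Matrix.GeneralLinearGroup (Fin 2) O), (ρ.toGaloisRep.IsIrreducible ∧ ∀ᶠ w : IsDedekindDomain.HeightOneSpectrum (NumberField.RingOfIntegers F) in Filter.cofinite, ρ.IsUnramifiedAt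 w ∧ ρ.HasFrobCharpolyAt w (Polynomial.X ^ 2 - Polynomial.C ((Literature.NumberTheory.Automorphic.frobTraceAt E w : ℤ) : PadicAlgCl p) * Polynomial.X + Polynomial.C ((w.residueCard : ℕ) : PadicAlgCl p))) → ρ.HasUpperTriangularIntegralModel ρ₀ → (∃ v : IsDedekindDomain.HeightOneSpectrum (NumberField.RingOfIntegers F), (p : NumberField.RingOfIntegers F) ∈ v.asIdeal ∧ ∀ m : ℕ, 0 < m → ¬ ρ.IsOrdinaryOfWeightAt p v 2 m) → ∃ 𝒰 : Literature.NumberTheory.Automorphic.BigHeckeGLn.TameLevel 2 F p, 𝒰.IsPadicallyAutomorphic ρ) →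
    (∀ (F : Type) [Field F] [NumberField F], NumberField.IsTotallyComplex F → Module.finrank ℚ F = 2 → ∀ (p : ℕ) [Fact p.Prime], p ≠ 2 → ∀ (E : WeierstrassCurve (NumberField.RingOfIntegers F)), E.Δ ≠ 0 → ¬ (E.baseChange F).HasCM → ¬ (E.baseChange F).HasIrreducibleModPGaloisRep p → ∀ (ρ : Literature.NumberTheory.GaloisRepresentations.FramedGaloisRep F (PadicAlgCl p) 2), (ρ.toGaloisRep.IsIrreducible ∧ ∀ᶠ w : IsDedekindDomain.HeightOneSpectrum (NumberField.RingOfIntegers F) in Filter.cofinite, ρ.IsUnramifiedAt w ∧ ρ.HasFrobCharpolyAt w (Polynomial.X ^ 2 - Polynomial.C ((Literature.NumberTheory.Automorphic.frobTraceAt E w : ℤ) : PadicAlgCl p) * Polynomial.X + Polynomial.C ((w.residueCard : ℕ) : PadicAlgCl p))) → (∃ v : IsDedekindDomain.HeightOneSpectrum (NumberField.RingOfIntegers F), (p : NumberField.RingOfIntegers F) ∈ v.asIdeal ∧ ∀ m : ℕ, 0 < m → ¬ ρ.IsOrdinaryOfWeightAt p v 2 m) → (∃ 𝒰 : Literature.NumberTheory.Automorphic.BigHeckeGLn.TameLevel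 2 F p, 𝒰.IsPadicallyAutomorphic ρ) → ∀ (hcpt : Literature.NumberTheory.Automorphic.isCompact_glFiniteIntegralLevel 2 F), ∃ π : Literature.NumberTheory.Automorphic.CuspidalAutomorphicRepData 2 F hcpt, π.1.IsLAlgebraic ∧ ∀ᶠ w : IsDedekindDomain.HeightOneSpectrum (NumberField.RingOfIntegers F) in Filter.cofinite, ∃ α : Multiset ℂ, π.1.HasSatakeParamAt w α ∧ (α.map fun a => a⁻¹).sum = (Literature.NumberTheory.Automorphic.frobTraceAt E w : ℂ) ∧ (α.map fun a => a⁻¹).prod = (w.residueCard : ℂ)) →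
    Summit.Langlands.Langlands.Theses.FifteenLocusEisenstein.NonOrdinaryEisensteinModular := by
  intro h1 h2 h3 F _ _ htc hdeg p _ hp E hΔ hcm hred hA hcpt
  obtain ⟨ρ, ρ₀, hframe, hmod⟩ := h1 F p E hΔ hcm hred _ rfl
  have hno : ∃ v : IsDedekindDomain.HeightOneSpectrum (NumberField.RingOfIntegers F),
      (p : NumberField.RingOfIntegers F) ∈ v.asIdeal ∧ ∀ m : ℕ, 0 < m → ¬ ρ.IsOrdinaryOfWeightAt p v 2 m := by
    by_contra h
    push Not at h
    exact hA ⟨ρ, hframe, h⟩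
  obtain ⟨𝒰, h𝒰⟩ := h2 F htc hdeg p hp _ rfl E hΔ hcm hred ρ ρ₀ hframe hmod hno
  exact h3 F htc hdeg p hp E hΔ hcm hred ρ hframe hno ⟨𝒰, h𝒰⟩ hcpt

/-- Sanity (read-back): the conclusion of `NonOrdinaryEisensteinModular_of` is the route decl, and the route
decl unfolds to the verbatim crux text used to cut the stubs. [bookkeeping] -/
example : Summit.Langlands.Langlands.Theses.FifteenLocusEisenstein.NonOrdinaryEisensteinModular ↔
    (∀ (F : Type) [Field F] [NumberField F], NumberField.IsTotallyComplex F → Module.finrank ℚ F = 2 → ∀ (p : ℕ) [Fact p.Prime], p ≠ 2 → ∀ (E : WeierstrassCurve (NumberField.RingOfIntegers F)), E.Δ ≠ 0 → ¬ (E.baseChange F).HasCM → ¬ (E.baseChange F).HasIrreducibleModPGaloisRep p → ¬ (∃ ρ : Literature.NumberTheory.GaloisRepresentations.FramedGaloisRep F (PadicAlgCl p) 2, (ρ.toGaloisRep.IsIrreducible ∧ ∀ᶠ w : IsDedekindDomain.HeightOneSpectrum (NumberField.RingOfIntegers F) in Filter.cofinite, ρ.IsUnramifiedAt w ∧ ρ.HasFrobCharpolyAt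 w (Polynomial.X ^ 2 - Polynomial.C ((Literature.NumberTheory.Automorphic.frobTraceAt E w : ℤ) : PadicAlgCl p) * Polynomial.X + Polynomial.C ((w.residueCard : ℕ) : PadicAlgCl p))) ∧ ∀ v : IsDedekindDomain.HeightOneSpectrum (NumberField.RingOfIntegers F), (p : NumberField.RingOfIntegers F) ∈ v.asIdeal → ∃ m : ℕ, 0 < m ∧ ρ.IsOrdinaryOfWeightAt p v 2 m) → ∀ (hcpt : Literature.NumberTheory.Automorphic.isCompact_glFiniteIntegralLevel 2 F), ∃ π : Literature.NumberTheory.Automorphic.CuspidalAutomorphicRepData 2 F hcpt, π.1.IsLAlgebraic ∧ ∀ᶠ w : IsDedekindDomain.HeightOneSpectrum (NumberField.RingOfIntegers F) in Filter.cofinite, ∃ α : Multiset ℂ, π.1.HasSatakeParamAt w α ∧ (α.map fun a => a⁻¹).sum = (Literature.NumberTheory.Automorphic.frobTraceAt E w : ℂ) ∧ (α.map fun a => a⁻¹).prod = (w.residueCard : ℂ)) :=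
  Iff.rfl

end Summit.Langlands.Langlands.Cruxes.NonOrdinaryEisensteinModular.Birth

end
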